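import Summits.QuantumAdvantage.AdviceFreeQNC0.GradedSeeds38ReductionS
import Summits.QuantumAdvantage.AdviceFreeQNC0.AffBells21Characters
import Summits.QuantumAdvantage.AdviceFreeQNC0.WalkCoordinates
import HarnessLib

/-!
# Cell qa-qnc0 — planner qa-qnc0-p1 g39 (ROUND-38): the alignment half of (R1) — cube / cover /
decision-tree alignment bounds (PROVED), and the typed targets of ROUND-38 §2, §5, §6

PROVED here (sorry-free):

* `norm_twisted_litCube_le` — for every `β : Fin N → 𝔽₃` and every set `C` of literals,
  `‖Σ_x ω^{β·x} · 1[x satisfies all literals of C]‖ ≤ 2^{#{i : β_i = 0}} = 2^{N − wt β}`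
  (separation of variables; the subcube may be empty or over-constrained);
* `norm_twisted_litCover_le` — a function that is a sum of `L` literal-cube indicators has twisted sum
  `≤ L · 2^{N − wt β}`;
* `DT.norm_twisted_le` / `DT.norm_twisted_le'` — for a DECISION TREE `t` of depth `d`,
  `‖Σ_x ω^{β·x} · 1[t accepts x]‖ ≤ 2^d · 2^{N − wt β} = 2^d · 2^{−wt β} · 2^N`
  (its accepting leaves are ≤ 2^d literal cubes: `DT.leaves_cover`, `DT.length_leaves_le`).
  This is step (i) of the proof of THEOREM 39.A (CSP alignment bound, ROUND-38 §5.1): after a random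
  restriction an `s`-CNF has small decision-tree depth (Håstad's switching lemma, not in the tree), and a
  depth-`t` tree cannot align with a character of free weight `w` better than `2^{t − w}`.
* `oneLetterTwistBound_of_juntaS` — (R1) = `TwistedJunta36.TwistedJuntaBoundX3S ρ` implies the
  one-letter rung `OneLetterTwistBound ρ` ((R1)_{s=1} of ROUND-38 §6.4, the recommended next target).

TYPED ONLY (statements of ROUND-38; `def … : Prop`, nothing claimed in Lean):
`LinBlindness` (Lemma B, §2 — proved in the memo by a rank-one transfer-matrix computation),
`CSPAlignment39A` (Theorem 39.A, §5.1 — proved in the memo from Håstad's switching lemma + `DT.norm_twisted_le`),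
`ThinnedJuntaBound λ` (Conjecture (II_λ), §5.2 — OPEN for 0 < λ < 1; λ = 1 FALSE by B-39.1),
`FewTermJuntaBound` (Claim K, §6.2 — OPEN), `OneLetterTwistBound κ` ((R1)_{s=1}, §6.4 — OPEN when typed; since PROVED for
`κ = 39/40`: `Blind39.oneLetterTwistBound`, file `R1OneFibre39.lean`, qn-prover-3 g25; `LinBlindness` is proved as
`UCoord39B.linBlindness_holds`).

Custody regime D-0168 E1: this file lives under `HOME/qa-qnc0-p1/exp39/`, farm `lean check` only; a summoned
prover may port the PROVED part next to `AffBells21Characters.lean`.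
-/

namespace Summit.QuantumAdvantage.AdviceFreeQNC0

open Finset Literature.Computability.QuantumComplexity Literature.Computability.QuantumComplexity.RingHLF
  Literature.Computability.MetaComplexity

namespace Blind39

variable {N : ℕ}

/-! ## §1 Weights and literal cubes -/

/-- The value `⟨β, x⟩ = Σ_{i : x_i} β_i ∈ 𝔽₃` of a linear form on a Boolean point. -/
def linVal (β : Fin N → ZMod 3) (x : Fin N → Bool) : ZMod 3 := ∑ i, if x i then β i else 0

/-- Hamming weight of `β`. -/
def wt (β : Fin N → ZMod 3) : ℕ := (univ.filter fun i => β i ≠ 0).card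

/-- Number of zero coordinates of `β`. -/
def zwt (β : Fin N → ZMod 3) : ℕ := (univ.filter fun i => β i = 0).card

/-- auxiliary lemma `wt_add_zwt` (planner p1 g39, exp39; ported verbatim). -/
theorem wt_add_zwt (β : Fin N → ZMod 3) : wt β + zwt β = N := by
  have h := Finset.card_filter_add_card_filter_not (s := (univ : Finset (Fin N))) (fun i => β i = 0)
  rw [card_univ, Fintype.card_fin] at h
  rw [add_comm]
  exact h

/-- auxiliary lemma `two_pow_zwt` (planner p1 g39, exp39; ported verbatim). -/
theorem two_pow_zwt (β : Fin N → ZMod 3) : (2 : ℝ) ^ zwt β = (2 : ℝ)⁻¹ ^ wt β * 2 ^ N := by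
  have h : (2 : ℝ) ^ zwt β * 2 ^ wt β = 2 ^ N := by rw [← pow_add, add_comm, wt_add_zwt]
  have h2 : (2 : ℝ) ^ wt β ≠ 0 := pow_ne_zero _ two_ne_zero
  rw [inv_pow, ← h]
  field_simp

/-- Indicator of the LITERAL CUBE `{x : x_{l.1} = l.2 for every literal l ∈ C}` (empty if `C` is contradictory). -/
def litInd (C : Finset (Fin N × Bool)) (x : Fin N → Bool) : ℂ := ∏ l ∈ C, (if x l.1 = l.2 then (1 : ℂ) else 0)

/-- auxiliary lemma `litInd_insert` (planner p1 g39, exp39; ported verbatim). -/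
theorem litInd_insert (l : Fin N × Bool) (C : Finset (Fin N × Bool)) (x : Fin N → Bool) :
    litInd (insert l C) x = (if x l.1 = l.2 then (1 : ℂ) else 0) * litInd C x := by
  unfold litInd
  by_cases h : l ∈ C
  · rw [insert_eq_of_mem h, ← mul_prod_erase C _ h]
    split_ifs <;> ring
  · rw [prod_insert h]

/-- auxiliary lemma `norm_litInd_le` (planner p1 g39, exp39; ported verbatim). -/
theorem norm_litInd_le (C : Finset (Fin N × Bool)) (x : Fin N → Bool) : ‖litInd C x‖ ≤ 1 := by
  unfold litInd
  rw [prod_boole]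
  split_ifs <;> simp

/-! ## §2 The cube alignment bound (separation of variables) -/

/-- **Cube alignment bound.**  `‖Σ_x ω^{⟨β,x⟩} · 1_{cube C}(x)‖ ≤ 2^{#{i : β_i = 0}}`: every coordinate free of
literals and carrying `β_i ≠ 0` contributes `|1 + ω^{β_i}| = 1` instead of `2`. -/
theorem norm_twisted_litCube_le (β : Fin N → ZMod 3) (C : Finset (Fin N × Bool)) :
    ‖∑ x : Fin N → Bool, (ZMod.stdAddChar (linVal β x) : ℂ) * litInd C x‖ ≤ (2 : ℝ) ^ zwt β := by
  set f : Fin N → Bool → ℂ := fun i b =>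
    (if b then (ZMod.stdAddChar (β i) : ℂ) else 1) *
      ∏ l ∈ C with l.1 = i, (if b = l.2 then (1 : ℂ) else 0) with hf
  -- separation of variables, pointwise
  have hterm : ∀ x : Fin N → Bool,
      (ZMod.stdAddChar (linVal β x) : ℂ) * litInd C x = ∏ i, f i (x i) := by
    intro x
    rw [linVal, TwoModuli.stdAddChar_sum_ite β x, litInd, ← prod_fiberwise C Prod.fst, ← prod_mul_distrib]
    refine prod_congr rfl fun i _ => ?_
    simp only [hf]
    congr 1
    refine prod_congr rfl fun l hl => ?_
    rw [(mem_filter.1 hl).2]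
  have hsum : ∑ x : Fin N → Bool, (ZMod.stdAddChar (linVal β x) : ℂ) * litInd C x = ∏ i, ∑ b : Bool, f i b := by
    rw [Fintype.prod_sum]
    exact sum_congr rfl fun x _ => hterm x
  -- the single-coordinate factors
  have hfac : ∀ i, ‖∑ b : Bool, f i b‖ ≤ if β i = 0 then (2 : ℝ) else 1 := by
    intro i
    rw [Fintype.sum_bool]
    by_cases hC : ∃ l ∈ C, l.1 = i
    · obtain ⟨l₀, hl₀C, hl₀⟩ := hC
      have hz : ∀ b : Bool, b ≠ l₀.2 → f i b = 0 := by
        intro b hb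
        simp only [hf]
        apply mul_eq_zero_of_right
        exact prod_eq_zero (i := l₀) (mem_filter.2 ⟨hl₀C, hl₀⟩) (if_neg hb)
      have h1 : ∀ b : Bool, ‖f i b‖ ≤ 1 := by
        intro b
        simp only [hf]
        rw [norm_mul]
        have ha : ‖(if b then (ZMod.stdAddChar (β i) : ℂ) else 1)‖ ≤ 1 := by
          split_ifs
          · exact le_of_eq (AffBells21.norm_stdAddChar_three _)
          · simp
        have hb : ‖∏ l ∈ C with l.1 = i, (if b = l.2 then (1 : ℂ) else 0)‖ ≤ 1 := by
          rw [prod_boole]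
          split_ifs <;> simp
        calc _ ≤ 1 * 1 := mul_le_mul ha hb (norm_nonneg _) zero_le_one
          _ = 1 := one_mul 1
      have hle : ‖f i true + f i false‖ ≤ 1 := by
        cases hv : l₀.2
        · rw [hz true (by rw [hv]; decide), zero_add]; exact h1 false
        · rw [hz false (by rw [hv]; decide), add_zero]; exact h1 true
      split_ifs <;> linarith
    · have hemp : (C.filter fun l => l.1 = i) = ∅ :=
        filter_eq_empty_iff.2 fun l hl h => hC ⟨l, hl, h⟩
      have ht : f i true = (ZMod.stdAddChar (β i) : ℂ) := by simp [hf, hemp]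
      have hf0 : f i false = 1 := by simp [hf, hemp]
      rw [ht, hf0]
      by_cases hβ : β i = 0
      · rw [if_pos hβ, hβ, AddChar.map_zero_eq_one]
        norm_num
      · rw [if_neg hβ, add_comm]
        have h := TwoModuli.norm_one_add_stdAddChar_le (p := 3) hβ
        have hcos : Real.cos (Real.pi / ((3 : ℕ) : ℝ)) = 1 / 2 := by
          rw [show ((3 : ℕ) : ℝ) = 3 by norm_num, Real.cos_pi_div_three]
        rw [hcos] at h
        linarith
  rw [hsum, norm_prod]
  calc ∏ i, ‖∑ b : Bool, f i b‖ ≤ ∏ i, (if β i = 0 then (2 : ℝ) else 1) :=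
        prod_le_prod (fun i _ => norm_nonneg _) fun i _ => hfac i
    _ = (2 : ℝ) ^ zwt β := by
        rw [prod_ite, prod_const, prod_const_one, mul_one]
        rfl

/-- **Cover alignment bound.**  A sum of `L` literal-cube indicators has twisted sum `≤ L · 2^{#{β_i = 0}}`. -/
theorem norm_twisted_litCover_le (β : Fin N → ZMod 3) :
    ∀ (Ds : List (Finset (Fin N × Bool))) (c : (Fin N → Bool) → ℂ),
      (∀ x, c x = (Ds.map fun D => litInd D x).sum) →
        ‖∑ x : Fin N → Bool, (ZMod.stdAddChar (linVal β x) : ℂ) * c x‖ ≤ (Ds.length : ℝ) * (2 : ℝ) ^ zwt β := by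
  intro Ds
  induction Ds with
  | nil =>
      intro c hc
      have h0 : ∀ x, c x = 0 := fun x => by rw [hc x]; rfl
      simp [h0]
  | cons D Ds ih =>
      intro c hc
      have hsplit : ∑ x : Fin N → Bool, (ZMod.stdAddChar (linVal β x) : ℂ) * c x =
          (∑ x : Fin N → Bool, (ZMod.stdAddChar (linVal β x) : ℂ) * litInd D x) +
            ∑ x : Fin N → Bool, (ZMod.stdAddChar (linVal β x) : ℂ) * (Ds.map fun D' => litInd D' x).sum := by
        rw [← sum_add_distrib]
        refine sum_congr rfl fun x _ => ?_
        rw [hc x, List.map_cons, List.sum_cons, mul_add]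
      rw [hsplit]
      calc _ ≤ ‖∑ x : Fin N → Bool, (ZMod.stdAddChar (linVal β x) : ℂ) * litInd D x‖ +
              ‖∑ x : Fin N → Bool, (ZMod.stdAddChar (linVal β x) : ℂ) * (Ds.map fun D' => litInd D' x).sum‖ :=
            norm_add_le _ _
        _ ≤ (2 : ℝ) ^ zwt β + (Ds.length : ℝ) * (2 : ℝ) ^ zwt β :=
            add_le_add (norm_twisted_litCube_le β D) (ih _ fun x => rfl)
        _ = ((D :: Ds).length : ℝ) * (2 : ℝ) ^ zwt β := by
            rw [List.length_cons]; push_cast; ring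

/-! ## §3 Decision trees -/

/-- Boolean decision trees over `N` variables (a variable may be re-queried; unreachable leaves are harmless). -/
inductive DT (N : ℕ) : Type
  | leaf : Bool → DT N
  | node : Fin N → DT N → DT N → DT N

namespace DT

/-- Evaluation. -/
def eval : DT N → (Fin N → Bool) → Bool
  | leaf b, _ => b
  | node i t₀ t₁, x => if x i = true then t₁.eval x else t₀.eval x

/-- Depth. -/
def depth : DT N → ℕ
  | leaf _ => 0
  | node _ t₀ t₁ => max t₀.depth t₁.depth + 1

/-- The accepting leaves below a path with literal set `C`, as literal cubes. -/
def leaves : DT N → Finset (Fin N × Bool) → List (Finset (Fin N × Bool))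
  | leaf true, C => [C]
  | leaf false, _ => []
  | node i t₀ t₁, C => t₀.leaves (insert (i, false) C) ++ t₁.leaves (insert (i, true) C)

/-- auxiliary lemma `length_leaves_le` (planner p1 g39, exp39; ported verbatim). -/
theorem length_leaves_le : ∀ (t : DT N) (C : Finset (Fin N × Bool)), (t.leaves C).length ≤ 2 ^ t.depth
  | leaf b, C => by cases b <;> simp [leaves, depth]
  | node i t₀ t₁, C => by
      rw [leaves, List.length_append, depth, pow_succ]
      have h₀ := length_leaves_le t₀ (insert (i, false) C)
      have h₁ := length_leaves_le t₁ (insert (i, true) C)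
      have e₀ : 2 ^ t₀.depth ≤ 2 ^ max t₀.depth t₁.depth := Nat.pow_le_pow_right (by norm_num) (le_max_left _ _)
      have e₁ : 2 ^ t₁.depth ≤ 2 ^ max t₀.depth t₁.depth := Nat.pow_le_pow_right (by norm_num) (le_max_right _ _)
      omega

/-- The accepting region below a path is the disjoint union of its accepting leaves. -/
theorem leaves_cover : ∀ (t : DT N) (C : Finset (Fin N × Bool)) (x : Fin N → Bool),
    litInd C x * (if t.eval x = true then (1 : ℂ) else 0) = ((t.leaves C).map fun D => litInd D x).sum
  | leaf b, C, x => by cases b <;> simp [eval, leaves]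
  | node i t₀ t₁, C, x => by
      rw [leaves, List.map_append, List.sum_append, ← leaves_cover t₀, ← leaves_cover t₁,
        litInd_insert, litInd_insert, eval]
      cases hx : x i <;> simp

/-- **Decision-tree alignment bound.**  A depth-`d` decision tree accepts a region whose twisted sum is
`≤ 2^d · 2^{#{β_i = 0}}`. -/
theorem norm_twisted_le (β : Fin N → ZMod 3) (t : DT N) :
    ‖∑ x : Fin N → Bool, (ZMod.stdAddChar (linVal β x) : ℂ) * (if t.eval x = true then (1 : ℂ) else 0)‖
      ≤ (2 : ℝ) ^ t.depth * (2 : ℝ) ^ zwt β := by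
  have hc : ∀ x : Fin N → Bool, (if t.eval x = true then (1 : ℂ) else 0) = ((t.leaves ∅).map fun D => litInd D x).sum := by
    intro x
    rw [← leaves_cover t ∅ x]
    simp [litInd]
  calc _ ≤ ((t.leaves ∅).length : ℝ) * (2 : ℝ) ^ zwt β := norm_twisted_litCover_le β _ _ hc
    _ ≤ (2 : ℝ) ^ t.depth * (2 : ℝ) ^ zwt β := by
        apply mul_le_mul_of_nonneg_right _ (by positivity)
        exact_mod_cast length_leaves_le t ∅

/-- The same bound in the size-normalised format of (R1): `2^d · 2^{−wt β} · 2^N`. -/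
theorem norm_twisted_le' (β : Fin N → ZMod 3) (t : DT N) :
    ‖∑ x : Fin N → Bool, (ZMod.stdAddChar (linVal β x) : ℂ) * (if t.eval x = true then (1 : ℂ) else 0)‖
      ≤ (2 : ℝ) ^ t.depth * (2 : ℝ)⁻¹ ^ wt β * 2 ^ N := by
  have h := norm_twisted_le β t
  rw [two_pow_zwt, ← mul_assoc] at h
  exact h

end DT

/-! ## §4 Typed targets of ROUND-38 (statements only) -/

/-- **Lemma B (linear blindness)** — ROUND-38 §2, proved in the memo (rank-one transfer matrices), NOT yet
in Lean: `|Σ_x ω^{a·W_k(x) + b·⟨r,x⟩}| ≤ 4·2^N / 2^{k − 2 s'}`, `s' = #(supp r ∩ [0,k))`, for `a ≠ 0` and `k ≤ N`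
(v2: the hypothesis `k ≤ N` is necessary — for `k ≥ N + 3`, `r = 0` the left side is `|(1+ω^a)^N| = 1 > 4·2^N/2^k`;
the u-coordinate proof is ROUND-38 §2 Lemma B″). -/
def LinBlindness : Prop :=
  ∀ (N k : ℕ) (r : Fin N → ZMod 3) (a b : ZMod 3), a ≠ 0 → k ≤ N →
    ‖∑ x : Fin N → Bool, (ZMod.stdAddChar (a * ((Wk x k : ℕ) : ZMod 3) + b * linVal r x) : ℂ)‖
      ≤ 4 * (2 : ℝ) ^ N / (2 : ℝ) ^ (k - 2 * (univ.filter fun i : Fin N => i.val < k ∧ r i ≠ 0).card)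

/-- A CNF as a list of clauses, a clause as a set of literals `(i, b)` meaning `x_i = b`. -/
def CNFSat (Φ : List (Finset (Fin N × Bool))) (x : Fin N → Bool) : Prop := ∀ c ∈ Φ, ∃ l ∈ c, x l.1 = l.2

/-- **Theorem 39.A (CSP alignment bound)** — ROUND-38 §5.1, proved in the memo from Håstad's switching lemma
and `DT.norm_twisted_le`; typed only: for every `s`-CNF `Φ` and every `β`,
`‖Σ_x ω^{⟨β,x⟩} 1[Φ(x)]‖ ≤ 4·e^{−wt β/(80 s)}·2^N`. -/
def CSPAlignment39A : Prop :=
  open scoped Classical in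
  ∀ (s N : ℕ), 1 ≤ s → ∀ Φ : List (Finset (Fin N × Bool)), (∀ c ∈ Φ, c.card ≤ s) →
    ∀ β : Fin N → ZMod 3,
      ‖∑ x : Fin N → Bool, (ZMod.stdAddChar (linVal β x) : ℂ) * (if CNFSat Φ x then (1 : ℂ) else 0)‖
        ≤ 4 * Real.exp (-(wt β : ℝ) / (80 * s)) * (2 : ℝ) ^ N

/-- Number of firing tests (single-pattern `s`-local terms, with multiplicity). -/
def hits (tests : List (Finset (Fin N × Bool))) (x : Fin N → Bool) : ℕ :=
  (tests.map fun t => if (∀ l ∈ t, x l.1 = l.2) then 1 else 0).sum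

/-- **Conjecture (II_λ) (thinned junta sums)** — ROUND-38 §5.2; OPEN for `0 < λ < 1`, `= CSPAlignment39A`'s
regime at `λ = 0`, FALSE at `λ = 1` (B-39.1). -/
def ThinnedJuntaBound (lam : ℝ) : Prop :=
  ∃ C c : ℝ, c < 1 ∧ ∀ (N s : ℕ), 1 ≤ s → ∀ tests : List (Finset (Fin N × Bool)), (∀ t ∈ tests, t.card ≤ s) →
    ∀ β : Fin N → ZMod 3,
      ‖∑ x : Fin N → Bool, (ZMod.stdAddChar (linVal β x) : ℂ) * ((-(lam : ℂ)) ^ hits tests x)‖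
        ≤ C * c ^ (wt β / s) * (2 : ℝ) ^ N

/-- **Claim K (few-term junta sums)** — ROUND-38 §6.2; OPEN (disjoint juntas: product of single-block
constants).  `M ≤ 2s` juntas of size `≤ s`; `U` = letters they cover. -/
def FewTermJuntaBound : Prop :=
  ∃ κ C : ℝ, κ < 1 ∧ ∀ (N s M : ℕ), 1 ≤ s → M ≤ 2 * s →
    ∀ (T : Fin M → Finset (Fin N)) (f : Fin M → (Fin N → Bool) → Bool),
      (∀ k, (T k).card ≤ s) → (∀ k (x x' : Fin N → Bool), (∀ i ∈ T k, x i = x' i) → f k x = f k x') →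
        ∀ β : Fin N → ZMod 3,
          let wU := (((univ : Finset (Fin M)).biUnion T).filter fun i => β i ≠ 0).card
          ‖∑ x : Fin N → Bool, (ZMod.stdAddChar (linVal β x) : ℂ) *
              (if (univ.filter fun k => f k x = true).card % 2 = 1 then (-1 : ℂ) else 1)‖
            ≤ C * κ ^ ((wU + s - 1) / s) * (2 : ℝ)⁻¹ ^ (wt β - wU) * (2 : ℝ) ^ N

/-- **(R1)_{s=1} (one-letter rung)** — ROUND-38 §6.4: bells reading ONE letter each (arbitrary positions,
many bells per letter, constant bells allowed), twisted odd-class sum `≤ N^A κ^{wt β} 2^N`.  Typed here as OPEN; PROVED for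
`κ = 39/40` (`A = 1`, `n₀ = 3`): `Blind39.oneLetterTwistBound`, file `R1OneFibre39.lean` (qn-prover-3 g25, fibre method). -/
def OneLetterTwistBound (κ : ℝ) : Prop :=
  open scoped Classical in
  ∃ A n₀ : ℕ, ∀ N ≥ n₀, ∀ (τ : Fin N → Fin N) (G : Fin N → Bool → Bool) (β : Fin N → ZMod 3),
    ‖∑ x : Fin N → Bool, (ZMod.stdAddChar (∑ i : Fin N, if x i then β i else 0) : ℂ) *
        (if (OddZeros x ∧ RingHLF.Rel x (fun k => G k (x (τ k)))) then (1 : ℂ) else 0)‖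
      ≤ (N : ℝ) ^ A * κ ^ wt β * (2 : ℝ) ^ N

/-- (R1) implies its one-letter rung (take `C = 0`, `W = ∅`, `T k = {τ k}`). -/
theorem oneLetterTwistBound_of_juntaS {ρ : ℝ} (h : TwistedJunta36.TwistedJuntaBoundX3S ρ) :
    OneLetterTwistBound ρ := by
  classical
  obtain ⟨A, n₀, hA⟩ := h 0
  refine ⟨A, n₀, fun N hN τ G β => ?_⟩
  have h1 := hA N hN ∅ (fun k => {τ k}) (fun k x => G k (x (τ k))) (by simp)
    (fun k => by simp) (fun k x x' hxx' => by rw [hxx' (τ k) (mem_singleton_self _)]) β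
  have hexp : ((univ.filter fun i : Fin N => i ∉ (∅ : Finset (Fin N)) ∧ β i ≠ 0).card / (Nat.log 2 N) ^ 0) = wt β := by
    rw [pow_zero, Nat.div_one]
    unfold wt
    congr 1
    ext i
    simp
  rw [hexp] at h1
  exact h1

end Blind39

end Summit.QuantumAdvantage.AdviceFreeQNC0
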